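import Mathlib
import Literature.Analysis.FluidPDE.Tao2016AveragedNS.ShiftSetCascadeFlows
import Literature.Analysis.FluidPDE.Tao2016AveragedNS.ShiftSetCascadeFlux
import Summits.NavierStokesRegularity.NavierStokesRegularity.Theorems.TaoLadderRungTwoFlatCertificateGluePicardStepOn
import Summits.NavierStokesRegularity.NavierStokesRegularity.Theorems.TaoLadderRungTwoFlatCertificateGlueCheckerRegionOn
import Summits.NavierStokesRegularity.NavierStokesRegularity.Theorems.TaoLadderRungTwoFlatCertificateGlueCheckerFieldArrayOn
import HarnessLib

/-!
# Certificate glue on a shift set `𝕊`, XXXII: FIELD RANGE ON A WEIGHTED BOX — `FieldRangeOn (wbox lo) (wbox hi) dlo dhi` (the hypothesis of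
  glue `picard_level` and of glue XXXI `stepRead_of_sectionNode`) from an enclosure of the weighted truncated field over the box and the input defect
  (helper for items stmt-NavierStokesRegularity-22987 `FlatGapCertificatesV2` (crux K_A♭ of route TaoLadderRungTwoFlat) and stmt-24295 K_A₂(64);
  cell harvest/h2-tao-ladder, p1 g15)

`pqcN_pxcoord`: the weighted truncated field `PQcN (pxcoord Y) (pxcoord Y)` at `d ↔ (i,k)` is `truncField Y i k / ω i k`. `boxI lo hi`: the
`IntervalD` box of two dyadic vectors; `mem_boxI_of_inBox`: a state in the weighted box has weighted coordinates in `boxI`. `wtab ω F`: the state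
table `ω i k · F_{idx(i,k)}` of a weighted vector (`pxcoord_wtab`). `fieldRangeOn_of_box`: a per-coordinate enclosure `Flo ≤ PQcN ≤ Fhi` on the box
and `PInputDefectOn … δ` ⇒ `FieldRangeOn (wbox lo) (wbox hi) (wtab ω (Flo − δ)) (wtab ω (Fhi + δ))`; `fieldRangeOn_of_pqBox`: the enclosure from
the interval evaluation `pqBox` over `boxI lo hi` (glue XXIV `mem_pqBox`).

HONEST FRAMING: Tao-type MODEL lattices (Tao 2016 §4/§6 vocabulary, shift-set parametrised); glue lemmas for a checker — NO certificate
instance exists in the tree, nothing is certified here, no stub is closed, nothing here is a statement about the Navier–Stokes equations.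
-/

-- the sub-problem namespace repeats the summit name by design (D-0017)
set_option linter.dupNamespace false

namespace Summit.NavierStokesRegularity.NavierStokesRegularity.Theorems

open Set Finset Literature.Analysis.FluidPDE Literature.Analysis.FluidPDE.TaoCascade
open Summit.NavierStokesRegularity.NavierStokesRegularity.Theorems.TaylorModelCert

namespace CertificateGlueOn

variable {m : ℕ} {Kb Ka : ℤ} {𝕊 : Finset (ℤ × ℤ × ℤ)} {ε₀ : ℝ} {α : Fin m → Fin m → Fin m → ℤ × ℤ × ℤ → ℝ}
  {ω : Fin m → ℤ → ℝ} {Eb Et : ℝ}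

/-! ### Weighted coordinates and indices -/

/-- `pxcoord Y ∘ finProdFinEquiv = pwcoord Y`. [folklore] -/
theorem pxcoord_comp_equiv (Y : Fin m → ℤ → ℝ) :
    pxcoord Kb Ka ω Y ∘ finProdFinEquiv = pwcoord Kb Ka ω Y := by
  funext c; simp [pxcoord]

/-- **The weighted truncated field is the truncated field in weighted coordinates**: `PQcN (pxcoord Y) (pxcoord Y) d = truncField Y i k / ω i k`,
`d ↔ (i,k)`. [folklore] -/
theorem pqcN_pxcoord (hω : ∀ i k, 0 < ω i k) (Y : Fin m → ℤ → ℝ) (d : Fin (m * winLen Kb Ka)) :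
    PQcN 𝕊 ε₀ α Kb Ka ω (pxcoord Kb Ka ω Y) (pxcoord Kb Ka ω Y) d =
      truncField 𝕊 ε₀ α Kb Ka Y (finProdFinEquiv.symm d).1 (shellAt Kb (finProdFinEquiv.symm d).2) /
        ω (finProdFinEquiv.symm d).1 (shellAt Kb (finProdFinEquiv.symm d).2) := by
  simp only [PQcN, PQc, pxcoord_comp_equiv, pwcoord, ← truncField_eq_biFieldOn, truncField_pwstate_pwcoord 𝕊 ε₀ α hω]

/-- The index of `(i, shellAt col)` is `finProdFinEquiv (i, col)`. [folklore] -/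
theorem idxOf_shellAt (c : Fin m × Fin (winLen Kb Ka)) (h : -Kb ≤ shellAt Kb c.2 ∧ shellAt Kb c.2 ≤ Ka) :
    idxOf Kb Ka c.1 (shellAt Kb c.2) h = finProdFinEquiv c := by
  unfold idxOf
  congr 1
  refine Prod.ext rfl (Fin.ext ?_)
  simp [shellAt]

/-! ### The interval box of two dyadic vectors -/

/-- The `IntervalD` box `[lo_d, hi_d]` of two dyadic vectors. [folklore] -/
def boxI {n : ℕ} (loD hiD : Array Dyad) (d : Fin n) : IntervalD := ⟨dgetD loD d, dgetD hiD d⟩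

/-- A state in the weighted box `[wbox lo, wbox hi]` has weighted coordinates in `boxI lo hi`. [folklore] -/
theorem mem_boxI_of_inBox (hKb : 0 ≤ Kb) (hKa : 1 ≤ Ka) (hω : ∀ i k, 0 < ω i k) {loD hiD : Array Dyad} {Y : Fin m → ℤ → ℝ}
    (hY : InBoxOn Kb Ka (wbox Kb Ka ω loD) (wbox Kb Ka ω hiD) Y) (d : Fin (m * winLen Kb Ka)) :
    IntervalD.mem (pxcoord Kb Ka ω Y d) (boxI (n := m * winLen Kb Ka) loD hiD d) := by
  have hKK : 0 ≤ Ka + Kb + 1 := by omega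
  set c := finProdFinEquiv.symm d with hc
  have hk := shellAt_mem hKK c.2
  have h := hY c.1 (shellAt Kb c.2) hk.1 hk.2
  have hidx : idxOf Kb Ka c.1 (shellAt Kb c.2) hk = d := by rw [idxOf_shellAt, hc, Equiv.apply_symm_apply]
  simp only [wbox, dif_pos hk, hidx] at h
  have hωp := hω c.1 (shellAt Kb c.2)
  simp only [IntervalD.mem, boxI, pxcoord, pwcoord, ← hc]
  constructor
  · rw [le_div_iff₀ hωp]; linarith [h.1]
  · rw [div_le_iff₀ hωp]; linarith [h.2]

/-! ### State tables of weighted vectors -/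

/-- The state table `ω i k · F_{idx(i,k)}` of a weighted vector (`0` beyond the window). [folklore] -/
noncomputable def wtab (Kb Ka : ℤ) (ω : Fin m → ℤ → ℝ) (F : Fin (m * winLen Kb Ka) → ℝ) (i : Fin m) (k : ℤ) : ℝ :=
  if h : -Kb ≤ k ∧ k ≤ Ka then ω i k * F (idxOf Kb Ka i k h) else 0

/-- Weighted coordinates of the state table recover the vector. [folklore] -/
theorem pxcoord_wtab (hKb : 0 ≤ Kb) (hKa : 1 ≤ Ka) (hω : ∀ i k, 0 < ω i k) (F : Fin (m * winLen Kb Ka) → ℝ)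
    (d : Fin (m * winLen Kb Ka)) : pxcoord Kb Ka ω (wtab Kb Ka ω F) d = F d := by
  have hKK : 0 ≤ Ka + Kb + 1 := by omega
  set c := finProdFinEquiv.symm d with hc
  have hk := shellAt_mem hKK c.2
  have hidx : idxOf Kb Ka c.1 (shellAt Kb c.2) hk = d := by rw [idxOf_shellAt, hc, Equiv.apply_symm_apply]
  simp only [pxcoord, pwcoord, ← hc, wtab, dif_pos hk, hidx]
  field_simp [(hω c.1 (shellAt Kb c.2)).ne']

/-- The state table at a window shell. [folklore] -/
theorem wtab_of_mem {F : Fin (m * winLen Kb Ka) → ℝ} (i : Fin m) {k : ℤ} (h : -Kb ≤ k ∧ k ≤ Ka) :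
    wtab Kb Ka ω F i k = ω i k * F (idxOf Kb Ka i k h) := by
  unfold wtab; rw [dif_pos h]

/-! ### The field range on the weighted box -/

/-- **FIELD RANGE ON A WEIGHTED BOX FROM A WEIGHTED ENCLOSURE AND THE INPUT DEFECT**: if `Flo_d ≤ PQcN (pxcoord Y)(pxcoord Y)_d ≤ Fhi_d` for
every state `Y` of the box and the input defect on the box is `≤ δ·ω`, then the full window field (edge inputs admissible) lies in
`[ω(Flo − δ), ω(Fhi + δ)]` on the box. [cite: MooreKearfottCloud2009, §6.2–6.4 (interval enclosures of ranges); cell certificate format, box layer] -/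
theorem fieldRangeOn_of_box (hKb : 0 ≤ Kb) (hKa : 1 ≤ Ka) (hω : ∀ i k, 0 < ω i k) {loD hiD : Array Dyad}
    {Flo Fhi : Fin (m * winLen Kb Ka) → ℝ} {δ : ℝ}
    (hF : ∀ Y, InBoxOn Kb Ka (wbox Kb Ka ω loD) (wbox Kb Ka ω hiD) Y → ∀ d,
      Flo d ≤ PQcN 𝕊 ε₀ α Kb Ka ω (pxcoord Kb Ka ω Y) (pxcoord Kb Ka ω Y) d ∧
        PQcN 𝕊 ε₀ α Kb Ka ω (pxcoord Kb Ka ω Y) (pxcoord Kb Ka ω Y) d ≤ Fhi d)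
    (hdef : PInputDefectOn 𝕊 ε₀ α Kb Ka Eb Et ω (wbox Kb Ka ω loD) (wbox Kb Ka ω hiD) δ) :
    FieldRangeOn 𝕊 ε₀ α Kb Ka Eb Et (wbox Kb Ka ω loD) (wbox Kb Ka ω hiD) (wtab Kb Ka ω fun d => Flo d - δ)
      (wtab Kb Ka ω fun d => Fhi d + δ) := by
  intro Y hY hb ht i k hk1 hk2
  have hw : -Kb ≤ k ∧ k ≤ Ka := ⟨hk1, hk2⟩
  have hd := hdef Y hY hb ht i k hk1 hk2
  rw [abs_le] at hd
  set d := idxOf Kb Ka i k hw with hdd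
  have hFd := hF Y hY d
  -- `PQcN … d = truncField Y i k / ω i k`
  have hcc : (k + Kb).toNat < winLen Kb Ka := by
    unfold winLen; rw [Int.toNat_lt_toNat (by omega)]; omega
  have hsymm : finProdFinEquiv.symm d = (i, ⟨(k + Kb).toNat, hcc⟩) := by
    rw [hdd]; unfold idxOf; rw [Equiv.symm_apply_apply]
  have hsh : shellAt Kb (⟨(k + Kb).toNat, hcc⟩ : Fin (winLen Kb Ka)) = k := by
    simp only [shellAt]; rw [Int.toNat_of_nonneg (by omega)]; ring
  rw [pqcN_pxcoord hω Y d, hsymm] at hFd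
  simp only [hsh] at hFd
  have hωp := hω i k
  rw [le_div_iff₀ hωp, div_le_iff₀ hωp] at hFd
  rw [wtab_of_mem i hw, wtab_of_mem i hw, ← hdd]
  constructor <;> nlinarith [hFd.1, hFd.2, hd.1, hd.2]

/-- **The enclosure from `pqBox` over the box** (glue XXIV `mem_pqBox`): per coordinate, `PQcN (pxcoord Y)(pxcoord Y)_d` lies in
`pqBox … (boxI lo hi) (boxI lo hi) d` for every state `Y` of the weighted box. [folklore] -/
theorem pqcN_mem_pqBox_of_inBox (hKb : 0 ≤ Kb) (hKa : 1 ≤ Ka) (hω : ∀ i k, 0 < ω i k) {shifts : List (ℤ × ℤ × ℤ)} (hnd : shifts.Nodup)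
    {coefB : Fin m → ℤ → Fin m → Fin m → ℤ × ℤ × ℤ → IntervalD} (hcoef : CoefBoxOK shifts ε₀ α Kb Ka ω coefB) (prec : ℕ)
    {loD hiD : Array Dyad} {Y : Fin m → ℤ → ℝ} (hY : InBoxOn Kb Ka (wbox Kb Ka ω loD) (wbox Kb Ka ω hiD) Y)
    (d : Fin (m * winLen Kb Ka)) :
    IntervalD.mem (PQcN shifts.toFinset ε₀ α Kb Ka ω (pxcoord Kb Ka ω Y) (pxcoord Kb Ka ω Y) d)
      (pqBox Kb Ka prec shifts coefB (boxI (n := m * winLen Kb Ka) loD hiD) (boxI (n := m * winLen Kb Ka) loD hiD) d) :=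
  mem_pqBox hKb hKa hnd hcoef (mem_boxI_of_inBox hKb hKa hω hY) (mem_boxI_of_inBox hKb hKa hω hY) d

/-- **`FieldRangeOn` ON THE WEIGHTED BOX FROM THE INTERVAL EVALUATION `pqBox` AND THE INPUT DEFECT** — the tables a checker computes.
[cite: MooreKearfottCloud2009, §6.2–6.4 (interval enclosures of ranges); cell certificate format, box layer] -/
theorem fieldRangeOn_of_pqBox (hKb : 0 ≤ Kb) (hKa : 1 ≤ Ka) (hω : ∀ i k, 0 < ω i k) {shifts : List (ℤ × ℤ × ℤ)}
    (hnd : shifts.Nodup) {coefB : Fin m → ℤ → Fin m → Fin m → ℤ × ℤ × ℤ → IntervalD}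
    (hcoef : CoefBoxOK shifts ε₀ α Kb Ka ω coefB) (prec : ℕ) {loD hiD : Array Dyad} {δ : ℝ}
    (hdef : PInputDefectOn shifts.toFinset ε₀ α Kb Ka Eb Et ω (wbox Kb Ka ω loD) (wbox Kb Ka ω hiD) δ) :
    FieldRangeOn shifts.toFinset ε₀ α Kb Ka Eb Et (wbox Kb Ka ω loD) (wbox Kb Ka ω hiD)
      (wtab Kb Ka ω fun d =>
        (pqBox Kb Ka prec shifts coefB (boxI (n := m * winLen Kb Ka) loD hiD) (boxI (n := m * winLen Kb Ka) loD hiD) d).lo.toReal - δ)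
      (wtab Kb Ka ω fun d =>
        (pqBox Kb Ka prec shifts coefB (boxI (n := m * winLen Kb Ka) loD hiD) (boxI (n := m * winLen Kb Ka) loD hiD) d).hi.toReal + δ) :=
  fieldRangeOn_of_box hKb hKa hω (fun _ hY d => pqcN_mem_pqBox_of_inBox hKb hKa hω hnd hcoef prec hY d) hdef

end CertificateGlueOn

end Summit.NavierStokesRegularity.NavierStokesRegularity.Theorems
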